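import Summits.Ventures.PercRepro.C041TriDomGlueInduction

/-!
# ROW C-041 — GLUING AT A CUT VERTEX, V: THE SIBLING IS THE CONJECTURE WITH A PENDANT EDGE
(p6, gen 45; P6-TWOEXIT-LEAN.md §53 ADDENDUM 16)

* **THE SIBLING DOMINATION IS THE CONJECTURE WITH A PENDANT EDGE** (`sibDominationS_iff_pendant`): let `f` join
  `v` and `z`, with `f` the only edge at `z` (`z` a leaf).  Then the sibling domination of `(x, y; v)` on the host
  with `f` deleted is EQUIVALENT to CONJECTURE (STOCHASTIC DOMINATION) for `(x, y, z)` on the host with `f` free.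
  (⟹) is THEOREM (CUT-VERTEX GLUING) with the far side `{f}` (fibre form): the far side has no `D`-type inside
  part, so the conjecture for `(x, y, v)` on the near side is not needed.  (⟸): the inside parts are «`f` red» and
  «`f` blue», and the conjecture at the up-set `fun ω => W (merge ω i)` reads exactly «first class + second class ≤
  target» on the fibre of `W` over `i`.
  Consequence (paper, ADDENDUM 16): THEOREM (CUT-VERTEX GLUING) turns an arbitrary far side into a single pendant
  edge, and CONJECTURE (STOCHASTIC DOMINATION) reduces to the hosts whose marks lie in one block, or in one block plus
  a pendant edge.
-/

namespace PercRepro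

namespace ZoneZ

namespace MultiExit

open ZoneData Finset GlueB

variable {V₁ E₁ U₁ U₂ : Type} (Z₁ : ZoneData V₁ E₁ U₁ U₂) (x y z v : V₁)

variable [Fintype E₁] [DecidableEq E₁]

/-! ## The pendant edge -/

section Pendant

variable (f : E₁)

/-- `f` joins `v` and `z`, and it is the only edge at `z` (`z` is a leaf). -/
def Pendant : Prop := Z₁.Joins f v z ∧ ∀ e, (Z₁.fst e = z ∨ Z₁.snd e = z) → e = f

omit [Fintype E₁] [DecidableEq E₁] in
/-- A pendant edge touches `z`. -/
theorem pendant_touches (hf : Pendant Z₁ z v f) : Z₁.fst f = z ∨ Z₁.snd f = z := by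
  rcases hf.1 with ⟨_, h2⟩ | ⟨h1, _⟩
  · exact Or.inr h2
  · exact Or.inl h1

omit [Fintype E₁] [DecidableEq E₁] in
/-- The `z`-side of `v` is `{z}` when `z` is a leaf at `v`. -/
theorem side_pendant (hz : z ≠ v) (hf : Pendant Z₁ z v f) :
    side Z₁ (fun _ => EStat.free) v z = {z} := by
  ext w
  simp only [Set.mem_singleton_iff]
  constructor
  · intro h
    unfold side at h
    rw [mem_reach_singleton] at h
    induction h with
    | refl => rfl
    | @tail a b _ hab ih =>
      subst ih
      obtain ⟨⟨e, hj, _⟩, ha, hb⟩ := hab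
      have he : e = f := hf.2 e (by
        rcases hj with ⟨h1, _⟩ | ⟨_, h2⟩
        · exact Or.inl h1
        · exact Or.inr h2)
      subst he
      -- `f` joins `z` and `b`, and `f` joins `v` and `z`: `b = v`
      exfalso
      rcases hj with ⟨h1, h2⟩ | ⟨h1, h2⟩ <;> rcases hf.1 with ⟨h3, h4⟩ | ⟨h3, h4⟩
      · exact hz (h1.symm.trans h3)
      · exact hb (h2.symm.trans h4)
      · exact hb (h1.symm.trans h3)
      · exact hz (h2.symm.trans h4)
  · rintro rfl
    exact mem_reach_self _ _

omit [Fintype E₁] [DecidableEq E₁] in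
/-- The far side of a pendant edge is the edge itself. -/
theorem InC_pendant (hz : z ≠ v) (hf : Pendant Z₁ z v f) (e : E₁) : InCS Z₁ (fun _ => EStat.free) v z e ↔ e = f := by
  unfold InCS ZoneData.Touches
  rw [side_pendant Z₁ z v f hz hf]
  simp only [Set.mem_singleton_iff]
  constructor
  · exact hf.2 e
  · intro he
    rw [he]
    exact pendant_touches Z₁ z v f hf

omit [Fintype E₁] [DecidableEq E₁] in
/-- The marks `x ≠ z` lie off the far side of a pendant edge. -/
theorem not_mem_side_pendant (hz : z ≠ v) (hf : Pendant Z₁ z v f) {a : V₁} (ha : a ≠ z) :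
    a ∉ side Z₁ (fun _ => EStat.free) v z := by
  rw [side_pendant Z₁ z v f hz hf]
  simpa using ha

omit [Fintype E₁] [DecidableEq E₁] in
/-- On the far side of a pendant edge, `v, z` are red-connected iff the edge is red. -/
theorem RdS_stIn_pendant (hz : z ≠ v) (hf : Pendant Z₁ z v f) (i : E₁ → Bool) :
    RdS Z₁ (stInS Z₁ (fun _ => EStat.free) v z) i v z ↔ i f = true := by
  constructor
  · intro h
    unfold RdS at h
    rw [mem_reach_singleton] at h
    have key : ∀ w, Relation.ReflTransGen (RAdjS Z₁ (stInS Z₁ (fun _ => EStat.free) v z) i) v w → w ≠ v → i f = true := by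
      intro w hw
      induction hw with
      | refl => intro h'; exact absurd rfl h'
      | @tail a b _ hab _ =>
        intro _
        obtain ⟨e, _, he⟩ := hab
        rw [redE_stInS, InC_pendant Z₁ z v f hz hf] at he
        obtain ⟨rfl, he⟩ := he
        exact (redE_free i _).mp he
    exact key z h hz
  · intro h
    unfold RdS
    rw [mem_reach_singleton]
    exact Relation.ReflTransGen.single ⟨f, hf.1, (redE_stInS Z₁ (fun _ => EStat.free) v z i f).mpr
      ⟨(InC_pendant Z₁ z v f hz hf f).mpr rfl, (redE_free i f).mpr h⟩⟩

omit [Fintype E₁] [DecidableEq E₁] in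
/-- On the far side of a pendant edge, `v, z` are blue-connected iff the edge is blue. -/
theorem MgS_stIn_pendant (hz : z ≠ v) (hf : Pendant Z₁ z v f) (i : E₁ → Bool) :
    MgS Z₁ (stInS Z₁ (fun _ => EStat.free) v z) i v z ↔ i f = false := by
  constructor
  · intro h
    unfold MgS at h
    rw [mem_reach_singleton] at h
    have key : ∀ w, Relation.ReflTransGen (BAdjS Z₁ (stInS Z₁ (fun _ => EStat.free) v z) i) v w → w ≠ v → i f = false := by
      intro w hw
      induction hw with
      | refl => intro h'; exact absurd rfl h'
      | @tail a b _ hab _ =>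
        intro _
        obtain ⟨e, _, he⟩ := hab
        rw [blueE_stInS, InC_pendant Z₁ z v f hz hf] at he
        obtain ⟨rfl, he⟩ := he
        exact (blueE_free i _).mp he
    exact key z h hz
  · intro h
    unfold MgS
    rw [mem_reach_singleton]
    exact Relation.ReflTransGen.single ⟨f, hf.1, (blueE_stInS Z₁ (fun _ => EStat.free) v z i f).mpr
      ⟨(InC_pendant Z₁ z v f hz hf f).mpr rfl, (blueE_free i f).mpr h⟩⟩

/-- The inside part «`f` red». -/
def iRed : E₁ → Bool := fun e => decide (e = f)

/-- The inside part «`f` blue» (all blue). -/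
def iBlue : E₁ → Bool := fun _ => false

open Classical in
/-- No inside part of a pendant edge is of type `D`. -/
theorem card_tD_pendant (hz : z ≠ v) (hf : Pendant Z₁ z v f) :
    ((InSupp (InCS Z₁ (fun _ => EStat.free) v z)).filter (tDinS Z₁ (fun _ => EStat.free) z v)).card = 0 := by
  rw [Finset.card_eq_zero]
  refine Finset.filter_false_of_mem fun i _ h => ?_
  obtain ⟨hR, hB⟩ := h
  rw [RdS_stIn_pendant Z₁ z v f hz hf] at hR
  rw [MgS_stIn_pendant Z₁ z v f hz hf] at hB
  rw [hR] at hB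
  exact Bool.noConfusion hB

open Classical in
/-- Exactly one inside part of a pendant edge is of type `R`: «`f` red». -/
theorem card_tR_pendant (hz : z ≠ v) (hf : Pendant Z₁ z v f) :
    ((InSupp (InCS Z₁ (fun _ => EStat.free) v z)).filter (tRinS Z₁ (fun _ => EStat.free) z v)).card = 1 := by
  rw [Finset.card_eq_one]
  refine ⟨iRed f, ?_⟩
  ext i
  rw [Finset.mem_filter, Finset.mem_singleton]
  constructor
  · rintro ⟨hsupp, hR, _⟩
    rw [InSupp, Finset.mem_filter] at hsupp
    have hf' : i f = true := (RdS_stIn_pendant Z₁ z v f hz hf i).mp hR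
    funext e
    by_cases he : e = f
    · rw [he, hf']
      simp [iRed]
    · rw [hsupp.2 e (fun h => he ((InC_pendant Z₁ z v f hz hf e).mp h))]
      simp [iRed, he]
  · rintro rfl
    refine ⟨?_, ?_, ?_⟩
    · rw [InSupp, Finset.mem_filter]
      refine ⟨Finset.mem_univ _, fun e he => ?_⟩
      rw [InC_pendant Z₁ z v f hz hf] at he
      simp [iRed, he]
    · exact (RdS_stIn_pendant Z₁ z v f hz hf _).mpr (by simp [iRed])
    · intro h
      have := (MgS_stIn_pendant Z₁ z v f hz hf _).mp h
      simp [iRed] at this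

open Classical in
/-- Exactly one inside part of a pendant edge is of type `B`: «`f` blue». -/
theorem card_tB_pendant (hz : z ≠ v) (hf : Pendant Z₁ z v f) :
    ((InSupp (InCS Z₁ (fun _ => EStat.free) v z)).filter (tBinS Z₁ (fun _ => EStat.free) z v)).card = 1 := by
  rw [Finset.card_eq_one]
  refine ⟨iBlue, ?_⟩
  ext i
  rw [Finset.mem_filter, Finset.mem_singleton]
  constructor
  · rintro ⟨hsupp, _, hB⟩
    rw [InSupp, Finset.mem_filter] at hsupp
    have hf' : i f = false := (MgS_stIn_pendant Z₁ z v f hz hf i).mp hB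
    funext e
    by_cases he : e = f
    · rw [he, hf']
      rfl
    · rw [hsupp.2 e (fun h => he ((InC_pendant Z₁ z v f hz hf e).mp h))]
      rfl
  · rintro rfl
    refine ⟨?_, ?_, ?_⟩
    · rw [InSupp, Finset.mem_filter]
      exact ⟨Finset.mem_univ _, fun _ _ => rfl⟩
    · intro h
      have := (RdS_stIn_pendant Z₁ z v f hz hf _).mp h
      simp [iBlue] at this
    · exact (MgS_stIn_pendant Z₁ z v f hz hf _).mpr rfl

omit [Fintype E₁] [DecidableEq E₁] in
/-- Merging twice with the same outside part: the last inside part wins. -/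
theorem merge_merge (In : E₁ → Prop) [DecidablePred In] (o j i : E₁ → Bool) :
    merge In (merge In o j) i = merge In o i := by
  funext e
  by_cases h : In e <;> simp [merge, h]

open Classical in
/-- **THE SIBLING DOMINATION ⟹ THE CONJECTURE WITH THE PENDANT EDGE** (THEOREM (CUT-VERTEX GLUING) with the far side
`{f}`; the `D`-fibres are empty, so no hypothesis on the near side beyond the sibling domination is needed). -/
theorem cycDomination_pendant_of_sib (hz : z ≠ v) (hf : Pendant Z₁ z v f) (hx : x ≠ z) (hy : y ≠ z)
    (h2 : SibDominationS Z₁ x y v (stOutS Z₁ (fun _ => EStat.free) v z)) : CycDomination Z₁ x y z := by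
  refine cycDominationS_of_cutVertex_fibres Z₁ (fun _ => EStat.free) x y z v hz (not_mem_side_pendant Z₁ z v f hz hf hx)
    (not_mem_side_pendant Z₁ z v f hz hf hy) (fun _ _ i hi => ?_) h2
  exfalso
  have h := card_tD_pendant Z₁ z v f hz hf
  rw [Finset.card_eq_zero] at h
  rw [h] at hi
  exact Finset.notMem_empty i hi

open Classical in
/-- A fibre count over the fibre of an up-set is a fibre count of the up-set (the last inside part wins). -/
theorem fibCS_fibre (W P : (E₁ → Bool) → Prop) (i j : E₁ → Bool) :
    fibCS Z₁ (fun _ => EStat.free) z v (fun ω => W (merge (InCS Z₁ (fun _ => EStat.free) v z) ω i)) P j = fibCS Z₁ (fun _ => EStat.free) z v W P i := by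
  unfold fibCS
  simp only [merge_merge]

open Classical in
/-- **THE CONJECTURE WITH THE PENDANT EDGE ⟹ THE SIBLING DOMINATION**: the inside parts are «`f` red» and
«`f` blue», and the conjecture at the up-set `fun ω => W (merge ω i)` is exactly «first class + second class ≤
target» on the fibre of `W` over `i`. -/
theorem sib_of_cycDomination_pendant (hz : z ≠ v) (hf : Pendant Z₁ z v f) (hx : x ≠ z) (hy : y ≠ z)
    (h : CycDomination Z₁ x y z) : SibDominationS Z₁ x y v (stOutS Z₁ (fun _ => EStat.free) v z) := by
  intro W hW
  have hx' := not_mem_side_pendant Z₁ z v f hz hf hx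
  have hy' := not_mem_side_pendant Z₁ z v f hz hf hy
  rw [card_filter_eq_sum_fibre (InCS Z₁ (fun _ => EStat.free) v z), card_filter_eq_sum_fibre (InCS Z₁ (fun _ => EStat.free) v z)]
  refine Finset.sum_le_sum fun i _ => ?_
  -- the conjecture at the fibre of `W` over `i`
  have hc := h (fun ω => W (merge (InCS Z₁ (fun _ => EStat.free) v z) ω i)) (upSet_fibreOut _ hW i)
  rw [card_filter_eq_sum_fibre (InCS Z₁ (fun _ => EStat.free) v z), card_filter_eq_sum_fibre (InCS Z₁ (fun _ => EStat.free) v z)] at hc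
  have e1 : ∀ o j, CycCrossed Z₁ x y z (merge (InCS Z₁ (fun _ => EStat.free) v z) o j) =
      CycCrossedS Z₁ x y z (fun _ => EStat.free) (merge (InCS Z₁ (fun _ => EStat.free) v z) o j) := fun _ _ => rfl
  have e2 : ∀ o j, TopBot Z₁ x y z (merge (InCS Z₁ (fun _ => EStat.free) v z) o j) =
      TopBotS Z₁ x y z (fun _ => EStat.free) (merge (InCS Z₁ (fun _ => EStat.free) v z) o j) := fun _ _ => rfl
  simp only [e1, e2] at hc
  rw [Finset.sum_congr rfl fun j _ => fibre_cycS Z₁ (fun _ => EStat.free) x y z v hz hx' hy' (fun ω => W (merge (InCS Z₁ (fun _ => EStat.free) v z) ω i)) j,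
    Finset.sum_congr rfl fun j _ => fibre_topS Z₁ (fun _ => EStat.free) x y z v hz hx' hy' (fun ω => W (merge (InCS Z₁ (fun _ => EStat.free) v z) ω i)) j] at hc
  simp only [fibCS_fibre] at hc
  rw [Finset.sum_add_distrib, Finset.sum_add_distrib, Finset.sum_add_distrib, ← Finset.sum_filter,
    ← Finset.sum_filter, ← Finset.sum_filter, ← Finset.sum_filter, ← Finset.sum_filter, Finset.sum_const,
    Finset.sum_const, Finset.sum_const, Finset.sum_const, Finset.sum_const, card_tD_pendant Z₁ z v f hz hf,
    card_tR_pendant Z₁ z v f hz hf, card_tB_pendant Z₁ z v f hz hf] at hc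
  simp only [zero_smul, one_smul, zero_add] at hc
  have hfinal : fibCS Z₁ (fun _ => EStat.free) z v W (fun o => SibC₁ Z₁ x y v (stOutS Z₁ (fun _ => EStat.free) v z) o ∨ SibC₃ Z₁ x y v (stOutS Z₁ (fun _ => EStat.free) v z) o) i ≤
      fibCS Z₁ (fun _ => EStat.free) z v W (SibTop Z₁ x y v (stOutS Z₁ (fun _ => EStat.free) v z)) i := by
    rw [fibS_or Z₁ (fun _ => EStat.free) z v (fun o h1 h3 => h3.2.1 h1.1)]
    omega
  -- the two fibres are fibre counts of the outside classes
  exact (card_filter_congr' fun o _ => and_congr_right fun _ => or_congr (sibC₁_stOutS_merge Z₁ (fun _ => EStat.free) x y z v o i)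
    (sibC₃_stOutS_merge Z₁ (fun _ => EStat.free) x y z v o i)).trans_le (hfinal.trans_eq
    (card_filter_congr' fun o _ => and_congr_right fun _ => (sibTop_stOutS_merge Z₁ (fun _ => EStat.free) x y z v o i).symm))

open Classical in
/-- **THE SIBLING DOMINATION IS THE CONJECTURE WITH A PENDANT EDGE**: for a leaf `z` hanging at `v` by the edge `f`,
the sibling domination of `(x, y; v)` with `f` deleted is equivalent to CONJECTURE (STOCHASTIC DOMINATION) for
`(x, y, z)` with `f` free. -/
theorem sibDominationS_iff_pendant (hz : z ≠ v) (hf : Pendant Z₁ z v f) (hx : x ≠ z) (hy : y ≠ z) :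
    SibDominationS Z₁ x y v (stOutS Z₁ (fun _ => EStat.free) v z) ↔ CycDomination Z₁ x y z :=
  ⟨cycDomination_pendant_of_sib Z₁ x y z v f hz hf hx hy, sib_of_cycDomination_pendant Z₁ x y z v f hz hf hx hy⟩

end Pendant

end MultiExit

end ZoneZ

end PercRepro
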